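import Literature.AnabelianGeometry.EtaleTheta.Discharge.Sec3Thm37UnitProfinite
import Literature.AnabelianGeometry.EtaleTheta.Discharge.Sec3Thm37UnitsOfDivisorial
import HarnessLib

/-!
# [EtTh] Theorem 3.7 (i) «unit-profinite type (Λ = ℤ)» from Proposition 3.4 (ii), and (iv) for `Λ = ℤ`,
# WITHOUT "`C` is a Frobenioid" — UNCONDITIONAL (no residual `hBmon`) at the canonical vocabulary

S. Mochizuki, *The étale theta function and its Frobenioid-theoretic manifestations*, Publ. RIMS **45**
(2009), Theorem 3.7 (i), (iv), PDF pp. 79–80 [cite: MochizukiEtTh2009, Thm 3.7 p.79]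
[cite: MochizukiEtTh2009, Thm 3.7 p.80], proof p. 80 ll. 4–6: "By Proposition 3.4, (ii) … it follows that
if, moreover, `Λ = ℤ` …, then `C` is of unit-profinite … type"; Proposition 3.4 (ii), PDF p. 74:
"`O_L^× ⥲ Ker(B₀(Y^log) → Φ₀^gp(Y^log))`" [cite: MochizukiEtTh2009, Prop 3.4 (ii) p.74].

PROOF-ONLY sequel (abc-iut cell, F fact-proving wave FLOAT, seat abc-iut-f-047; FACT-LIST rows F-0743
`Thm37_i`, F-0744 `Thm37_iv`) of seat abc-iut-w5-d164's `Sec3Thm37UnitProfinite.lean`, whose theorems carry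
`hF : IsFrobenioid C₀.toElem` — at the canonical vocabulary the residual `hBmon : IsMonoidOn B` — besides the
printed input `hP34` (for every `A ∈ Ob(D)`, `Ker(B₀^Λ(Y_A)^× → (Φ₀^ℝ)^gp(Y_A)) ≅ O_L^×` for a finite
extension `L` of `ℚ_p`). With `Sec3Thm37UnitsOfDivisorial.lean` (seat abc-iut-f-047: the unit chain needs
only divisorial `Φ(A_D)`, the (iv)-step only sharp `Φ(A_D)`), `hF` is replaced by
`hΦ : ∀ A, IsDivisorial (Φ(A))`, which the canonical vocabulary `treeCatVocab` supplies for free: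
* `isOfUnitProfiniteType_of_isDivisorial_of_kerIsoPadicUnits`, `thm37_iv_of_isDivisorial_of_kerIsoPadicUnits`,
  `thm37_i_unitConjunctsReal_of_isDivisorial_of_kerIsoPadicUnits` (any vocabulary, divisorial `Φ(A_D)`);
* **`thm37_i_unitProfinite_and_iv_ofRlfZ_treeCatVocab_of_kerIsoPadicUnits`** — for the CONSTRUCTED `Λ = ℤ`
  data `ofRlfZ` at `treeCatVocab`: Thm. 3.7 (i) "unit-profinite type" and Thm. 3.7 (iv) from the Prop. 3.4
  (ii) isomorphisms `hP34` ALONE (supersedes `thm37_i_unitProfinite_and_iv_ofRlfZ_treeCatVocab (hBmon) (hP34)`).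
No definition; nothing here bears on [IUTchIII] Cor. 3.12; `hP34` is a printed input, not a new fact; typed ≠
proved elsewhere.
-/

namespace Literature.AnabelianGeometry.EtaleTheta

open CategoryTheory Opposite Literature.AlgebraicGeometry.Frobenioids

universe u₀ v₀ u v w uK

namespace TemperedFrobenioid

section General

variable {D₀ : Type u₀} [Category.{v₀} D₀] {V : FrdIMonoidStub.{w}}
  {T : RealifiedDivisorMonoids (D₀ := D₀) V} {D : Type u} [Category.{v} D]
  {VD : FrdICatStub.{u, v, w} D} (C₀ : TemperedFrobenioid T D VD) {p : ℕ} [Fact p.Prime]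

/-- **(L06) Thm. 3.7 (i), "`C` is of unit-profinite type" (`Λ = ℤ`), from Prop. 3.4 (ii), without `hF`**:
for divisorial `Φ(A_D)`, if every kernel `Ker(B₀^Λ(Y_A)^× → (Φ₀^ℝ)^gp(Y_A))` is isomorphic to the unit group
`O_L^×` of a finite extension `L` of `ℚ_p`, the tempered Frobenioid is of unit-profinite type ([FrdI] Def.
2.8 (i)): `O^×(A) ≅ Ker ≅ O_L^×`, a topologically finitely generated profinite group ([FrdII] Thm. 1.2 (i)).
[cite: MochizukiEtTh2009, Thm 3.7 p.79] -/
theorem isOfUnitProfiniteType_of_isDivisorial_of_kerIsoPadicUnits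
    (hΦ : ∀ A : D, IsDivisorial (C₀.divisorMonoid.obj (op A)))
    (hP34 : ∀ A : Dᵒᵖ, ∃ L : PadicFrd.PadicFld.{uK} p, L.IsPadicLocal ∧
      Nonempty (((T.divΛ (C₀.baseOp A)).comp (Units.coeHom (T.BΛ.obj (C₀.baseOp A)))).ker ≃*
        PadicFrd.unitSubgroup L.K)) :
    PreFrobenioid.IsOfUnitProfiniteType C₀.toElem :=
  C₀.isOfUnitProfiniteType_of_isDivisorial_of_ker hΦ fun A => by
    obtain ⟨L, hL, ⟨e⟩⟩ := hP34 A
    exact AdmitsTfgProfiniteTopology.of_mulEquiv e.symm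
      (PadicFrd.PadicFld.admitsTfgProfiniteTopology_unitSubgroup L hL)

/-- **Thm. 3.7 (iv) for `Λ = ℤ` data from Prop. 3.4 (ii), without `hF`** (divisorial `Φ(A_D)`): "`D` slim
⟹ `C` slim" from the isomorphisms `hP34` alone — unit-profinite type gives `⋂ₙ O^×(A)ⁿ = 1`, then [FrdI]
Prop. 1.13 (iii)(b) for model categories. [cite: MochizukiEtTh2009, Thm 3.7 p.80] -/
theorem thm37_iv_of_isDivisorial_of_kerIsoPadicUnits
    (hΦ : ∀ A : D, IsDivisorial (C₀.divisorMonoid.obj (op A)))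
    (hP34 : ∀ A : Dᵒᵖ, ∃ L : PadicFrd.PadicFld.{uK} p, L.IsPadicLocal ∧
      Nonempty (((T.divΛ (C₀.baseOp A)).comp (Units.coeHom (T.BΛ.obj (C₀.baseOp A)))).ker ≃*
        PadicFrd.unitSubgroup L.K)) :
    C₀.Thm37_iv :=
  C₀.thm37_iv_of_sharp_of_isOfUnitProfiniteType (fun A => (hΦ A).isSharp)
    (C₀.isOfUnitProfiniteType_of_isDivisorial_of_kerIsoPadicUnits hΦ hP34)

/-- **Both UNIT conjuncts of Thm. 3.7 (i) in REAL vocabulary** for data of monoid type `ℤ`, without `hF`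
(divisorial `Φ(A_D)`, and `hP34`; the `Λ = ℝ` conjunct is vacuous). [cite: MochizukiEtTh2009, Thm 3.7 p.79] -/
theorem thm37_i_unitConjunctsReal_of_isDivisorial_of_kerIsoPadicUnits (hZ : C₀.monoidType = MonoidType.Z)
    (hΦ : ∀ A : D, IsDivisorial (C₀.divisorMonoid.obj (op A)))
    (hP34 : ∀ A : Dᵒᵖ, ∃ L : PadicFrd.PadicFld.{uK} p, L.IsPadicLocal ∧
      Nonempty (((T.divΛ (C₀.baseOp A)).comp (Units.coeHom (T.BΛ.obj (C₀.baseOp A)))).ker ≃*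
        PadicFrd.unitSubgroup L.K)) :
    (C₀.monoidType = MonoidType.Z → PreFrobenioid.IsOfUnitProfiniteType C₀.toElem) ∧
      (C₀.monoidType = MonoidType.R →
        PreFrobenioid.IsOfType (PreFrobenioid.IsUnitTrivial C₀.toElem)) :=
  ⟨fun _ => C₀.isOfUnitProfiniteType_of_isDivisorial_of_kerIsoPadicUnits hΦ hP34,
    fun h => absurd (hZ.symm.trans h) (by decide)⟩

end General

/-! ### At the canonical [FrdI] vocabulary for the constructed `Λ = ℤ` data `ofRlfZ`: no `hBmon` -/

section OfRlfZ

variable {D₀ : Type u₀} [Category.{v₀} D₀] (dm : DivisorMonoids.{u₀, v₀, w} D₀)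
  (hpf : ∀ Y : D₀ᵒᵖ, IsPerfFactorial (dm.Φ₀.obj Y)) {D : Type u} [Category.{v} D]
  {IsRational IsStrictlyRational : (Dᵒᵖ ⥤ CommMonCat.{w}) → Prop}
  (C₁ : TemperedFrobenioid (RealifiedDivisorMonoids.ofRlfZ dm hpf) D
    (treeCatVocab D IsRational IsStrictlyRational)) {p : ℕ} [Fact p.Prime]

/-- For the CONSTRUCTED Def. 3.6 (i) data of monoid type `ℤ` (`ofRlfZ`) at the canonical vocabulary:
**Thm. 3.7 (i) "unit-profinite type" and Thm. 3.7 (iv) from the Prop. 3.4 (ii) isomorphisms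
`Ker(B₀(Y_A)^× → (Φ₀^ℝ)^gp) ≅ O_L^×` ALONE** — no `hBmon` (supersedes
`thm37_i_unitProfinite_and_iv_ofRlfZ_treeCatVocab`). [cite: MochizukiEtTh2009, Thm 3.7 p.80] -/
theorem thm37_i_unitProfinite_and_iv_ofRlfZ_treeCatVocab_of_kerIsoPadicUnits
    (hP34 : ∀ A : Dᵒᵖ, ∃ L : PadicFrd.PadicFld.{uK} p, L.IsPadicLocal ∧
      Nonempty ((((RealifiedDivisorMonoids.ofRlfZ dm hpf).divΛ (C₁.baseOp A)).comp
        (Units.coeHom ((RealifiedDivisorMonoids.ofRlfZ dm hpf).BΛ.obj (C₁.baseOp A)))).ker ≃*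
        PadicFrd.unitSubgroup L.K)) :
    PreFrobenioid.IsOfUnitProfiniteType C₁.toElem ∧ C₁.Thm37_iv :=
  ⟨C₁.isOfUnitProfiniteType_of_isDivisorial_of_kerIsoPadicUnits C₁.isDivisorial_divisorMonoid hP34,
    C₁.thm37_iv_of_isDivisorial_of_kerIsoPadicUnits C₁.isDivisorial_divisorMonoid hP34⟩

end OfRlfZ

end TemperedFrobenioid

end Literature.AnabelianGeometry.EtaleTheta
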